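import Literature.Computability.QuantumComplexity.BQPJoinClosure
import Literature.Computability.QuantumComplexity.MultiCopy
import Literature.Computability.QuantumComplexity.WireConjugation
import HarnessLib

/-!
# Juxtaposed deciders: finitely many uniform quantum circuit families run side by side on one input

Topic `Literature/Computability/QuantumComplexity`. The circuit-level content of the closure of `BQP`
and `PromiseBQP` under (polynomial-time) Boolean combinations of finitely many bounded-error quantum
tests — "run `k` independent copies … on fresh tape and combine the answers classically"
(Bennett–Bernstein–Brassard–Vazirani 1997, Thm. 4.13 and Cor. 4.15; Bernstein–Vazirani 1997, §8;
for promise problems Watrous 2009, §III.2: nothing is promised off `Q.yes ∪ Q.no`, so a combination is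
sound only if its value is robust to the answers of the tests queried off their promise — which is a
hypothesis on the PRODUCT MEASURE of the answer bits, `isQSolvable_bit`). Given oracle-free uniform
Clifford+`T` families `fam j` (`j < m`), on input `x` of length `n` a polynomial-time generator prints
ONE circuit (`Juxt.circ`) on `W n = m · bw n + 1` wires, `bw n = n + Σ_j ancillas_j n + 1`:

* a word of `X = HSSH` gates writing a copy of `x` at the start of each of the `m` blocks
  `[j · bw, (j+1) · bw)` (`Juxt.content`, `xWords_inWires_mulVec`);
* the gates of `(fam j).circ n` transported to block `j` (`Juxt.blockCirc`, `mapWires`), for every `j`.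

Proved here: the output state is the product of the block states (`runOn_circ`, frame rule of
`CircuitEmbedding.lean`); wire `0` of block `j` reads `1` with exactly the acceptance probability of
`fam j` on `x` (`blockWeight_true`, idle wires being irrelevant, `sum_normSq_placeGate_castLE`); hence
**`probEvent_circ`**: the tuple of answer wires follows the product of the answer laws
(`MultiCopy.prob_event_prodState`); the raw description of the circuit (`rawGates_circ`: conditional `X`
words over the wire range, the families' raw gates with wire numerals shifted block by block,
`shiftRaw`) is computed on codes in polynomial time from `x` (**`codeFP_gen`**, in the typed `FP` algebra:
the indexed raw descriptions of uniform families `codeFP_idescs`, `UExec.flatMapRange`, `CodeFP.map`,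
`flatten`); the answer bits are read at the positions `j · bw |x|` of the measured string
(`ansBits`, `codeFP_ansBit`); and the assembly through the universal executor
(`isQSolvable_of_generated_circuits`) and `mem_BQP_of_isQSolvable_bit`:

* **`Juxt.isQSolvable_bit`** / **`Juxt.mem_BQP_of_truthTable`**: if `Φ x γ` (a Boolean function of the
  input and of the answer tuple, computed on codes) agrees with the target bit `bit x` on a set of
  answer patterns of product-measure mass `≥ 2/3` for every `x`, then `x ↦ [bit x]` is `IsQSolvable`,
  resp. `{x | bit x} ∈ BQP`;
* `Juxt.prod_le_sum_of_cylinder`: the mass of a cylinder `{γ | γ|_S = π|_S}` is `∏_{j ∈ S} w_j(π_j)` —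
  the form in which error budgets are discharged (only the promised sides of the tests enter).

Everything is proved; no named fact is introduced. NOT here: the amplification of the individual
tests (`PromiseBQPWith_eq_PromiseBQP`, `BQPMajorityAmplification.lean`), adaptive (sequential)
combinations (`SeqChain*.lean`).

## References

* C. H. Bennett, E. Bernstein, G. Brassard, U. Vazirani, *Strengths and weaknesses of quantum computing*,
  SIAM J. Comput. 26 (1997) 1510–1523, Thm. 4.13 (independent copies side by side), Cor. 4.15
  [BennettBernsteinBrassardVazirani1997].
* E. Bernstein, U. Vazirani, *Quantum complexity theory*, SIAM J. Comput. 26 (1997), §8 (classical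
  computation inside quantum machines) [BernsteinVazirani1997].
* J. Watrous, *Quantum computational complexity*, arXiv:0804.3401 (2009), §III.2 (promise problems,
  `BQP(a, b)`) [Watrous2009].
* M. A. Nielsen, I. L. Chuang, *Quantum Computation and Quantum Information*, CUP 2010, §2.1.7 eq. (2.45),
  §2.2.5, §2.2.8 (one register of a product state), §4.2 Ex. 4.18 (`X = HZH`), §4.3, §4.5
  [NielsenChuang2010].
* S. Arora, B. Barak, *Computational Complexity: A Modern Approach*, CUP 2009, §1.3, §6.2 and Remark 6.7
  (descriptions of uniform families are printed in polynomial time) [AroraBarak2009].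
-/

noncomputable section

namespace Literature.Computability.QuantumComplexity

open _root_.Computability Complexity Complexity.CodeFP Cryptography Matrix

namespace Juxt

variable {m : ℕ} (fam : Fin m → QCircuitFamily cliffordT)

/-! ### Layout -/

/-- The total ancilla count of the families on inputs of length `n`. [folklore] -/
def anc (n : ℕ) : ℕ := ∑ j, (fam j).ancillas n

/-- The block width: the input, all ancillas, and one idle wire (so that every block has a wire `0`). [folklore] -/
def bw (n : ℕ) : ℕ := n + anc fam n + 1

/-- The total number of wires: `m` blocks and one idle wire (so that the register is nonempty). [folklore] -/
def W (n : ℕ) : ℕ := m * bw fam n + 1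

/-- Blocks are nonempty. [folklore] -/
theorem bw_pos (n : ℕ) : 0 < bw fam n := Nat.succ_pos _

/-- The circuit of family `j` fits into a block. [folklore] -/
theorem fits (n : ℕ) (j : Fin m) : n + (fam j).ancillas n ≤ bw fam n := by
  have : (fam j).ancillas n ≤ anc fam n :=
    Finset.single_le_sum (f := fun j => (fam j).ancillas n) (fun _ _ => Nat.zero_le _) (Finset.mem_univ j)
  unfold bw; omega

/-- Wire `i` of block `j` lies below `m · bw`. [folklore] -/
theorem blk_lt_mul (n : ℕ) (j : Fin m) (i : Fin (bw fam n)) : (j : ℕ) * bw fam n + i < m * bw fam n := by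
  have h1 : (j : ℕ) * bw fam n + i < ((j : ℕ) + 1) * bw fam n := by
    rw [Nat.succ_mul]; exact Nat.add_lt_add_left i.isLt _
  exact lt_of_lt_of_le h1 (Nat.mul_le_mul_right _ j.isLt)

/-- Wire `i` of block `j` is a wire. [folklore] -/
theorem blk_lt (n : ℕ) (j : Fin m) (i : Fin (bw fam n)) : (j : ℕ) * bw fam n + i < W fam n :=
  (blk_lt_mul fam n j i).trans (Nat.lt_succ_self _)

/-- **Block `j`**: the wires `j · bw, …, (j + 1) · bw - 1`. [folklore] -/
def blk (n : ℕ) (j : Fin m) : Fin (bw fam n) ↪ Fin (W fam n) :=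
  ⟨fun i => ⟨(j : ℕ) * bw fam n + i, blk_lt fam n j i⟩, fun i i' h => Fin.ext (by simpa using congrArg Fin.val h)⟩

/-- The wire numeral of wire `i` of block `j`. [folklore] -/
@[simp] theorem blk_apply_val (n : ℕ) (j : Fin m) (i : Fin (bw fam n)) :
    ((blk fam n j i : Fin (W fam n)) : ℕ) = (j : ℕ) * bw fam n + i := rfl

/-- The block index of a block wire. [folklore] -/
theorem div_blk (n : ℕ) (j : Fin m) (i : Fin (bw fam n)) : ((j : ℕ) * bw fam n + i) / bw fam n = j := by
  rw [Nat.add_comm, Nat.add_mul_div_right _ _ (bw_pos fam n), Nat.div_eq_of_lt i.isLt, Nat.zero_add]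

/-- The position inside the block of a block wire. [folklore] -/
theorem mod_blk (n : ℕ) (j : Fin m) (i : Fin (bw fam n)) : ((j : ℕ) * bw fam n + i) % bw fam n = i := by
  rw [Nat.add_comm, Nat.add_mul_mod_self_right, Nat.mod_eq_of_lt i.isLt]

/-- **The blocks are pairwise disjoint.** [folklore] -/
theorem blockDisjoint_blk (n : ℕ) : BlockDisjoint (blk fam n) := by
  intro j j' hjj'
  rw [Set.disjoint_left]
  rintro w ⟨i, rfl⟩ ⟨i', h⟩
  have hv := congrArg Fin.val h
  simp only [blk_apply_val] at hv
  have h1 := div_blk fam n j' i'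
  rw [hv, div_blk] at h1
  exact hjj' (Fin.ext h1)

/-! ### The generated circuit -/

/-- The circuit of family `j` on inputs of length `n`, placed on the first wires of a block. [folklore] -/
def blockCirc (n : ℕ) (j : Fin m) : QCircuit cliffordT (bw fam n) :=
  mapWires (Fin.castLEEmb (fits fam n j)) ((fam j).circ n)

/-- **The content written on the register before the blocks run**: wire `w` of block `j < m` holds
`x[w mod bw]` (so each block starts with `|x⟩|0…0⟩`), the idle last wire holds `0`. [folklore] -/
def content (x : List Bool) (w : ℕ) : Bool :=
  decide (w < m * bw fam x.length) && x.getD (w % bw fam x.length) false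

/-- The wires to flip. [folklore] -/
def inWires (x : List Bool) : List (Fin (W fam x.length)) :=
  (List.finRange _).filter fun i => content fam x i

/-- **The generated circuit on input `x`**: write a copy of `x` at the start of every block by `X`
gates, then run the circuit of family `j` on block `j`, for every `j`.
[cite: BennettBernsteinBrassardVazirani1997, Thm. 4.13 (independent copies on fresh tape)] -/
def circ (x : List Bool) : QCircuit cliffordT (W fam x.length) :=
  ⟨BQPJoin.xWords (inWires fam x) ++
    (List.finRange m).flatMap fun j => (mapWires (blk fam x.length j) (blockCirc fam x.length j)).gates⟩

/-- Every generated circuit has a wire. [folklore] -/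
theorem one_le_W (x : List Bool) : 1 ≤ W fam x.length := Nat.succ_le_succ (Nat.zero_le _)

/-- The generated circuits are oracle-free when the families are. [folklore] -/
theorem circ_isOracleFree (hfree : ∀ j, (fam j).IsOracleFree) (x : List Bool) : (circ fam x).IsOracleFree := by
  intro g hg
  simp only [circ, List.mem_append, BQPJoin.xWords, List.mem_flatMap] at hg
  rcases hg with ⟨i, -, hg⟩ | ⟨j, -, hg⟩
  · exact xWord_isOracleFree i g hg
  · exact isOracleFree_mapWires _ (isOracleFree_mapWires _ (hfree j _)) g hg

/-! ### The state after the input is written, and after the blocks have run -/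

/-- The padded input `|x⟩|0…0⟩` of a block. [folklore] -/
def xpad (x : List Bool) : QReg (bw fam x.length) := fun i => x.getD i false

/-- The written content as a register. [folklore] -/
def creg (x : List Bool) : QReg (W fam x.length) := fun w => content fam x w

/-- **Writing the input**: the `X` word turns `|0…0⟩` into the written content. [cite: NielsenChuang2010, §4.2 Ex. 4.18] -/
theorem xWords_inWires_mulVec (A : Language Bool) (x : List Bool) :
    (⟨BQPJoin.xWords (inWires fam x)⟩ : QCircuit cliffordT (W fam x.length)).toMatrix A *ᵥ basisState (fun _ => false) =
      basisState (creg fam x) := by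
  rw [BQPJoin.xWords_mulVec_basisState]
  congr 1; funext i
  have hnd : (inWires fam x).Nodup := (List.nodup_finRange _).filter _
  by_cases hm : i ∈ inWires fam x
  · rw [List.count_eq_one_of_mem hnd hm]
    exact ((List.mem_filter.1 hm).2).symm
  · have hz : content fam x i = false := by simpa [inWires] using hm
    rw [List.count_eq_zero.2 hm]
    exact hz.symm

/-- Every block starts with the padded input. [folklore] -/
theorem creg_comp_blk (x : List Bool) (j : Fin m) : creg fam x ∘ blk fam x.length j = xpad fam x := by
  funext i
  show (decide (((blk fam x.length j i : Fin _) : ℕ) < m * bw fam x.length) &&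
    x.getD (((blk fam x.length j i : Fin _) : ℕ) % bw fam x.length) false) = x.getD i false
  rw [blk_apply_val, mod_blk, decide_eq_true (blk_lt_mul fam x.length j i), Bool.true_and]

/-- **The state of block `j` after its circuit has run** on `|x⟩|0…0⟩`. [folklore] -/
def blockState (x : List Bool) (j : Fin m) : QReg (bw fam x.length) → ℂ :=
  (blockCirc fam x.length j).toMatrix 0 *ᵥ basisState (xpad fam x)

/-- **The output state of the generated circuit is the product of the block states** (frame rule).
[cite: NielsenChuang2010, §2.1.7 eq. (2.45)] -/
theorem runOn_circ (hfree : ∀ j, (fam j).IsOracleFree) (A : Language Bool) (x : List Bool) :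
    (circ fam x).runOn A (basisState fun _ => false) = prodState (blk fam x.length) (blockState fam x) (creg fam x) := by
  have hsplit : circ fam x = (⟨BQPJoin.xWords (inWires fam x)⟩ : QCircuit cliffordT _).append
      ⟨(List.finRange m).flatMap fun j => (mapWires (blk fam x.length j) (blockCirc fam x.length j)).gates⟩ := rfl
  rw [QCircuit.runOn, hsplit, QCircuit.toMatrix_append, ← Matrix.mulVec_mulVec, xWords_inWires_mulVec,
    basisState_eq_prodState (blk fam x.length) (creg fam x),
    toMatrix_flatMap_mapWires_mulVec_prodState A (blockDisjoint_blk fam _)]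
  congr 1
  funext j
  rw [creg_comp_blk, blockState, QCircuit.toMatrix_eq_of_isOracleFree (C := blockCirc fam x.length j)
    (isOracleFree_mapWires _ (hfree j _)) A 0]


/-! ### The answer wires and their statistics -/

/-- Wire `0` of a block (the answer wire of the family run there). [folklore] -/
def wire0 (n : ℕ) : Fin (bw fam n) := ⟨0, bw_pos fam n⟩

/-- **The weight of the answer `c`** of the family `F` on input `x`: the acceptance probability for
`c = 1` and its complement for `c = 0`. [cite: NielsenChuang2010, §2.2.5] -/
def answerWeight (F : QCircuitFamily cliffordT) (x : List Bool) (c : Bool) : ℝ :=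
  if c then F.acceptProbOn 0 x else 1 - F.acceptProbOn 0 x

/-- The two answer weights sum to one. [folklore] -/
theorem answerWeight_true_add_false (F : QCircuitFamily cliffordT) (x : List Bool) :
    answerWeight F x true + answerWeight F x false = 1 := by
  simp [answerWeight]

/-- Answer weights are nonnegative (acceptance probabilities lie in `[0, 1]`). [folklore] -/
theorem answerWeight_nonneg (F : QCircuitFamily cliffordT) (x : List Bool) (c : Bool) : 0 ≤ answerWeight F x c := by
  cases c
  · have : F.acceptProbOn 0 x ≤ 1 := QCircuit.acceptProb_le_one_holds cliffordT_isUnitary_holds 0 _ _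
    simp only [answerWeight, Bool.false_eq_true, ↓reduceIte]; linarith
  · exact QCircuitFamily.acceptProbOn_nonneg 0 F x

/-- The first wires of a block hold the padded input `|x⟩|0…0⟩` of the family. [folklore] -/
theorem xpad_comp_castLE (x : List Bool) (j : Fin m) :
    xpad fam x ∘ Fin.castLEEmb (fits fam x.length j) = padInput x.get ((fam j).ancillas x.length) := by
  rw [BQPJoin.padInput_get_eq]; rfl

/-- **The answer wire of block `j` reads `1` with the acceptance probability of family `j` on `x`**
(idle wires do not change the statistics; on the empty register both sides vanish).
[cite: NielsenChuang2010, §2.2.8 (measurement of one register of a product state)] -/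
theorem blockWeight_true (x : List Bool) (j : Fin m) :
    blockWeight (wire0 fam x.length) (blockState fam x j) true = (fam j).acceptProbOn 0 x := by
  classical
  rw [blockWeight, Finset.sum_filter, blockState, blockCirc, toMatrix_mapWires, QCircuitFamily.acceptProbOn, QCircuit.acceptProb]
  set U := ((fam j).circ x.length).toMatrix 0
  by_cases hpos : 0 < x.length + (fam j).ancillas x.length
  · calc (∑ y : QReg (bw fam x.length), if y (wire0 fam x.length) = true then
            ‖(placeGate (Fin.castLEEmb (fits fam x.length j)) U *ᵥ basisState (xpad fam x)) y‖ ^ 2 else 0)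
          = ∑ u : QReg (x.length + (fam j).ancillas x.length),
              if u ⟨0, hpos⟩ = true then ‖U u (xpad fam x ∘ Fin.castLEEmb (fits fam x.length j))‖ ^ 2 else 0 :=
            sum_normSq_placeGate_castLE (fits fam x.length j) U (xpad fam x) (fun u => u ⟨0, hpos⟩ = true)
      _ = _ := Finset.sum_congr rfl fun u _ => by rw [dif_pos hpos, QCircuit.runOn, mulVec_basisState, xpad_comp_castLE]
  · have hx : ∀ i : Fin (bw fam x.length), x.length + (fam j).ancillas x.length ≤ (i : ℕ) → xpad fam x i = false :=
      fun i _ => List.getD_eq_default _ _ (by omega)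
    trans (0 : ℝ)
    · refine Finset.sum_eq_zero fun y _ => ?_
      split_ifs with hy
      · rw [placeGate_castLE_mulVec_basisState (fits fam x.length j) U (xpad fam x) hx y, if_neg, norm_zero,
          zero_pow two_ne_zero]
        intro hall
        rw [hall (wire0 fam x.length) (by simp only [wire0]; omega)] at hy
        exact Bool.false_ne_true hy
      · rfl
    · symm
      exact Finset.sum_eq_zero fun y _ => by rw [dif_neg hpos]

/-- The block states are unit vectors. [cite: NielsenChuang2010, §2.1.6] -/
theorem normSq_blockState (x : List Bool) (j : Fin m) : normSq (blockState fam x j) = 1 := by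
  rw [blockState, normSq_mulVec_of_mem_unitaryGroup (QCircuit.toMatrix_mem_unitaryGroup_holds cliffordT_isUnitary_holds 0 _),
    normSq_basisState]

/-- **The answer wire of block `j` reads `c` with the answer weight of family `j`.** [cite: NielsenChuang2010, §2.2.8] -/
theorem blockWeight_eq_answerWeight (x : List Bool) (j : Fin m) (c : Bool) :
    blockWeight (wire0 fam x.length) (blockState fam x j) c = answerWeight (fam j) x c := by
  cases c
  · have h := blockWeight_true_eq (wire0 fam x.length) (normSq_blockState fam x j)
    rw [blockWeight_true] at h
    simp only [answerWeight, Bool.false_eq_true, ↓reduceIte]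
    linarith
  · exact blockWeight_true fam x j

/-- **The statistics of the answer wires**: the probability that the tuple of answer wires of the
generated circuit lies in a set `S` of patterns is the product measure of the answer weights of `S`
(product Born rule on the product of the block states). [cite: NielsenChuang2010, §2.2.8] -/
theorem probEvent_circ (hfree : ∀ j, (fam j).IsOracleFree) (x : List Bool) (S : Finset (Fin m → Bool)) :
    (circ fam x).probEvent 0 (basisState fun _ => false)
        {f | (fun j => f (blk fam x.length j (wire0 fam x.length))) ∈ S} =
      ∑ γ ∈ S, ∏ j, answerWeight (fam j) x (γ j) := by
  classical
  calc (circ fam x).probEvent 0 (basisState fun _ => false) {f | (fun j => f (blk fam x.length j (wire0 fam x.length))) ∈ S}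
      = ∑ z ∈ Finset.univ.filter (fun z : QReg (W fam x.length) => (fun j => z (blk fam x.length j (wire0 fam x.length))) ∈ S),
          ‖prodState (blk fam x.length) (blockState fam x) (creg fam x) z‖ ^ 2 := by
        rw [QCircuit.probEvent, runOn_circ fam hfree]
        exact Finset.sum_congr (by ext z; simp) fun _ _ => rfl
    _ = ∑ γ ∈ S, ∏ j, blockWeight (wire0 fam x.length) (blockState fam x j) (γ j) :=
        prob_event_prodState (blockDisjoint_blk fam _) (wire0 fam x.length) (blockState fam x) (creg fam x) S
    _ = _ := Finset.sum_congr rfl fun γ _ => Finset.prod_congr rfl fun j _ => blockWeight_eq_answerWeight fam x j (γ j)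

/-! ### The raw description of the generated circuit -/

/-- A raw gate with all its wire numerals shifted by `off`. [folklore] -/
def shiftRaw (off : ℕ) (γ : RawGate) : RawGate := (γ.1, γ.2.1, γ.2.2.map (off + ·))

/-- Transport into block `j` shifts the wire numerals by `j · bw`. [folklore] -/
theorem toRaw_mapWiresGate_blk (n : ℕ) (j : Fin m) (γ : QGate cliffordT (n + (fam j).ancillas n)) :
    (mapWiresGate (blk fam n j) (mapWiresGate (Fin.castLEEmb (fits fam n j)) γ)).toRaw = shiftRaw (j * bw fam n) γ.toRaw := by
  cases γ with
  | gate g e => simp only [mapWiresGate, QGate.toRaw, shiftRaw, List.map_ofFn]; rfl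
  | oracle k e => simp only [mapWiresGate, QGate.toRaw, shiftRaw, List.map_ofFn]; rfl

/-- The raw gates of the blocks: the raw gates of the families' circuits, shifted block by block. [folklore] -/
theorem rawGates_blocks (n : ℕ) :
    ((List.finRange m).flatMap fun j => (mapWires (blk fam n j) (blockCirc fam n j)).gates).map QGate.toRaw =
      (List.finRange m).flatMap fun j => ((fam j).circ n).rawGates.map (shiftRaw (j * bw fam n)) := by
  rw [List.map_flatMap]
  refine List.flatMap_congr fun j _ => ?_
  rw [blockCirc, gates_mapWires, gates_mapWires, List.map_map, List.map_map, QCircuit.rawGates, List.map_map]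
  exact List.map_congr_left fun γ _ => toRaw_mapWiresGate_blk fam n j γ

/-- The raw gates of the input-writing word. [folklore] -/
theorem map_toRaw_xWords_inWires (x : List Bool) : (BQPJoin.xWords (inWires fam x)).map QGate.toRaw =
    (List.range (W fam x.length)).flatMap fun i => if content fam x i then BQPJoin.xRaw i else [] := by
  rw [BQPJoin.map_toRaw_xWords, inWires, BQPJoin.flatMap_filter_eq]
  exact UExec.flatMap_finRange_eq (W fam x.length) fun i => if content fam x i then BQPJoin.xRaw i else []

/-- **The raw description of the generated circuit.** [folklore] -/
theorem rawGates_circ (x : List Bool) : (circ fam x).rawGates =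
    ((List.range (W fam x.length)).flatMap fun i => if content fam x i then BQPJoin.xRaw i else []) ++
      (List.finRange m).flatMap fun j => ((fam j).circ x.length).rawGates.map (shiftRaw (j * bw fam x.length)) := by
  rw [circ, QCircuit.rawGates, List.map_append, map_toRaw_xWords_inWires, rawGates_blocks]

/-! ### The generator is polynomial time -/

/-- Shifting the wires of a raw gate is computed on codes. [cite: AroraBarak2009, §1.3] -/
theorem codeFP_shiftRaw : CodeFP (pairE natE RawGate.E) RawGate.E (fun p => shiftRaw p.1 p.2) := by
  have hoff : CodeFP (pairE natE RawGate.E) natE (fun p => p.1) := fst _ _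
  have hγ : CodeFP (pairE natE RawGate.E) RawGate.E (fun p => p.2) := snd _ _
  have htag : CodeFP (pairE natE RawGate.E) bitE (fun p => p.2.1) := RawGate.codeFP_tag.comp hγ
  have hbody : CodeFP (pairE natE RawGate.E) (pairE natE (listE natE)) (fun p => p.2.2) := RawGate.codeFP_body.comp hγ
  have hws : CodeFP (pairE natE RawGate.E) (rawE natE) (fun p => p.2.2.2) := (rawOfList natE).comp hbody.snd'
  have hmap : CodeFP (pairE natE RawGate.E) (rawE natE) (fun p => p.2.2.2.map fun w => p.1 + w) :=
    (map natAdd).comp (hoff.pair hws)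
  have hws' : CodeFP (pairE natE RawGate.E) (listE natE) (fun p => p.2.2.2.map fun w => p.1 + w) :=
    (listOfRaw natE).comp hmap
  exact (RawGate.codeFP_mk.comp (htag.pair (hbody.fst'.pair hws'))).congr fun p => rfl

/-- **The indexed raw descriptions of the families are computed on codes** from the unary input
length (by induction on the number of families). [cite: AroraBarak2009, §6.2 (Remark 6.7)] -/
theorem codeFP_idescs : ∀ (k : ℕ) (F : Fin k → QCircuitFamily cliffordT), (∀ j, (F j).IsUniform) →
    CodeFP unE (rawE (pairE natE RawDesc.E)) (fun n => List.ofFn fun j : Fin k => ((j : ℕ), (F j).rawDesc n))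
  | 0, F, _ => (const unE ([] : List (ℕ × RawDesc))).congr fun n => by simp
  | k + 1, F, hU => by
    have h0 : CodeFP unE (pairE natE RawDesc.E) (fun n => ((0 : ℕ), (F 0).rawDesc n)) :=
      (const unE 0).pair (codeFP_rawDesc (hU 0))
    have ih := codeFP_idescs k (fun j => F j.succ) (fun j => hU j.succ)
    have hsucc : CodeFP (pairE natE RawDesc.E) (pairE natE RawDesc.E) (fun p : ℕ × RawDesc => (p.1 + 1, p.2)) :=
      (natAdd.comp ((fst _ _).pair (const _ 1))).pair (snd _ _)
    exact ((rawCons _).comp (h0.pair ((map₀ hsucc).comp ih))).congr fun n => by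
      rw [List.ofFn_succ, List.map_ofFn]; rfl

/-- The total ancilla count in unary. [folklore] -/
theorem codeFP_anc (hU : ∀ j, (fam j).IsUniform) : CodeFP unE unE (anc fam) :=
  (unSum.comp ((map₀ ((snd natE RawDesc.E).snd'.fst')).comp (codeFP_idescs m fam hU))).congr fun n => by
    rw [List.map_ofFn, anc, ← Fin.sum_ofFn]; rfl

/-- The block width in unary. [folklore] -/
theorem codeFP_bw (hU : ∀ j, (fam j).IsUniform) : CodeFP unE unE (bw fam) :=
  (unSucc.comp (unAdd.comp ((CodeFP.id unE).pair (codeFP_anc fam hU)))).congr fun _ => rfl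

/-- The wire count in unary. [folklore] -/
theorem codeFP_W (hU : ∀ j, (fam j).IsUniform) : CodeFP unE unE (W fam) :=
  (unSucc.comp ((unMulConst m).comp (codeFP_bw fam hU))).congr fun _ => rfl

/-- **The raw gates of the blocks are computed on codes.** [cite: AroraBarak2009, §6.2 (Remark 6.7)] -/
theorem codeFP_blocks (hU : ∀ j, (fam j).IsUniform) : CodeFP unE (rawE RawGate.E)
    (fun n => (List.finRange m).flatMap fun j => ((fam j).circ n).rawGates.map (shiftRaw (j * bw fam n))) := by
  have hb : CodeFP (pairE natE (pairE natE RawDesc.E)) natE (fun q => q.1) := fst _ _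
  have hj : CodeFP (pairE natE (pairE natE RawDesc.E)) natE (fun q => q.2.1) := (snd _ _).fst'
  have hD : CodeFP (pairE natE (pairE natE RawDesc.E)) (rawE RawGate.E) (fun q => q.2.2.2.2) := (snd _ _).snd'.snd'.snd'
  have hbody : CodeFP (pairE natE (pairE natE RawDesc.E)) (rawE RawGate.E)
      (fun q => q.2.2.2.2.map fun γ => shiftRaw (q.2.1 * q.1) γ) :=
    ((map codeFP_shiftRaw).comp ((natMul.comp (hj.pair hb)).pair hD)).congr fun q => rfl
  have hctx : CodeFP unE (pairE natE (rawE (pairE natE RawDesc.E)))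
      (fun n => (bw fam n, List.ofFn fun j : Fin m => ((j : ℕ), (fam j).rawDesc n))) :=
    (natOfUn.comp (codeFP_bw fam hU)).pair (codeFP_idescs m fam hU)
  exact ((flatten RawGate.E).comp ((map hbody).comp hctx)).congr fun n => by
    rw [List.map_ofFn, List.ofFn_eq_map, ← List.flatMap_def]; rfl

/-- The written content is computed on codes. [folklore] -/
theorem codeFP_content (hU : ∀ j, (fam j).IsUniform) : CodeFP (pairE strE natE) bitE (fun p => content fam p.1 p.2) := by
  have hx : CodeFP (pairE strE natE) strE (fun p => p.1) := fst _ _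
  have hi : CodeFP (pairE strE natE) natE (fun p => p.2) := snd _ _
  have hbw : CodeFP (pairE strE natE) natE (fun p => bw fam p.1.length) :=
    (natOfUn.comp ((codeFP_bw fam hU).comp (strLength.comp hx))).congr fun _ => rfl
  have hlt : CodeFP (pairE strE natE) bitE (fun p => decide (p.2 < m * bw fam p.1.length)) :=
    natLt.comp (hi.pair (natMul.comp ((const _ m).pair hbw)))
  have hget : CodeFP (pairE strE natE) bitE (fun p => p.1.getD (p.2 % bw fam p.1.length) false) :=
    strGetDNat.comp (hx.pair (natMod.comp (hi.pair hbw)))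
  exact (hlt.and hget).congr fun p => rfl

/-- **The generator is polynomial time**: `x ↦ (1^{W |x|}, rawGates (circ x))` on codes, for uniform
families (their descriptions are printed in polynomial time, Arora–Barak 2009, Remark 6.7).
[cite: BennettBernsteinBrassardVazirani1997, Thm. 4.13 (the running time of the copies)] -/
theorem codeFP_gen (hU : ∀ j, (fam j).IsUniform) : CodeFP strE UExec.tcE fun x => (W fam x.length, (circ fam x).rawGates) := by
  have hW : CodeFP strE unE (fun x => W fam x.length) := (codeFP_W fam hU).comp strLength
  have hX : CodeFP strE (rawE RawGate.E) (fun x => (List.range (W fam x.length)).flatMap fun i =>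
      if content fam x i then BQPJoin.xRaw i else []) :=
    UExec.flatMapRange (F := fun x i => if content fam x i then BQPJoin.xRaw i else []) hW
      ((codeFP_content fam hU).ite (BQPJoin.codeFP_xRaw.comp (snd strE natE)) (const _ []))
  have hB : CodeFP strE (rawE RawGate.E) (fun x => (List.finRange m).flatMap fun j =>
      ((fam j).circ x.length).rawGates.map (shiftRaw (j * bw fam x.length))) := (codeFP_blocks fam hU).comp strLength
  exact (hW.pair ((rawAppend RawGate.E).comp (hX.pair hB))).congr fun x => by dsimp only; rw [rawGates_circ]

/-! ### Reading the answers and solving the decision problem -/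

/-- **The answer bits read off a measured string** `y` of the generated circuit on `x`: bit `j · bw |x|`
(the answer wire of block `j`). [folklore] -/
def ansBits (x y : List Bool) : Fin m → Bool := fun j => y.getD (j * bw fam x.length) false

/-- `getD` of `List.ofFn` inside the range. [folklore] -/
theorem getD_ofFn_of_lt {N : ℕ} (f : QReg N) {i : ℕ} (hi : i < N) (d : Bool) : (List.ofFn f).getD i d = f ⟨i, hi⟩ := by
  rw [List.getD_eq_getElem?_getD, List.getElem?_ofFn]
  simp [hi]

/-- On the measured register of the generated circuit the answer bits are the answer wires. [folklore] -/
theorem ansBits_ofFn (x : List Bool) (f : QReg (W fam x.length)) :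
    ansBits fam x (List.ofFn f) = fun j => f (blk fam x.length j (wire0 fam x.length)) := by
  funext j
  rw [ansBits, getD_ofFn_of_lt f (lt_of_le_of_lt (Nat.le_add_right _ _) (blk_lt fam x.length j (wire0 fam x.length)))]
  rfl

/-- The block width in binary, from the input. [folklore] -/
theorem codeFP_bw_length (hU : ∀ j, (fam j).IsUniform) : CodeFP strE natE (fun x => bw fam x.length) :=
  (natOfUn.comp ((codeFP_bw fam hU).comp strLength)).congr fun _ => rfl

/-- **Each answer bit is computed on codes** from the pair `⟨x, y⟩` (for building post-processors).
[cite: AroraBarak2009, §1.3] -/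
theorem codeFP_ansBit (hU : ∀ j, (fam j).IsUniform) (j : Fin m) :
    CodeFP (pairE strE strE) bitE (fun p => ansBits fam p.1 p.2 j) :=
  (strGetDNat.comp ((snd strE strE).pair (natMul.comp ((const _ (j : ℕ)).pair
    ((codeFP_bw_length fam hU).comp (fst strE strE)))))).congr fun _ => rfl

/-- **Product measures dominate their cylinders.** For weights `w j c ≥ 0` with `w j 1 + w j 0 = 1`, the
mass of the patterns `γ` satisfying `P` is at least `∏_{j ∈ S} w j (π j)` as soon as every pattern that
agrees with `π` on `S` satisfies `P` (the other coordinates integrate out). [folklore] -/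
theorem prod_le_sum_of_cylinder {k : ℕ} (w : Fin k → Bool → ℝ) (hw0 : ∀ j c, 0 ≤ w j c)
    (hw1 : ∀ j, w j true + w j false = 1) (S : Finset (Fin k)) (π : Fin k → Bool)
    (P : (Fin k → Bool) → Prop) [DecidablePred P] (hP : ∀ γ, (∀ j ∈ S, γ j = π j) → P γ) :
    ∏ j ∈ S, w j (π j) ≤ ∑ γ, if P γ then ∏ j, w j (γ j) else 0 := by
  classical
  have hfac : ∀ j, (∑ c, if j ∈ S → c = π j then w j c else 0) = if j ∈ S then w j (π j) else 1 := by
    intro j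
    by_cases hj : j ∈ S
    · rw [if_pos hj, Fintype.sum_bool]
      cases π j <;> simp [hj]
    · rw [if_neg hj, Fintype.sum_bool]
      simp [hj, hw1 j]
  calc ∏ j ∈ S, w j (π j) = ∏ j, (if j ∈ S then w j (π j) else 1) := by rw [Finset.prod_ite_mem, Finset.univ_inter]
    _ = ∏ j, ∑ c, (if j ∈ S → c = π j then w j c else 0) := Finset.prod_congr rfl fun j _ => (hfac j).symm
    _ = ∑ γ : Fin k → Bool, ∏ j, (if j ∈ S → γ j = π j then w j (γ j) else 0) :=
        Fintype.prod_sum fun j c => if j ∈ S → c = π j then w j c else 0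
    _ ≤ ∑ γ, if P γ then ∏ j, w j (γ j) else 0 := Finset.sum_le_sum fun γ _ => by
        by_cases hγ : ∀ j ∈ S, γ j = π j
        · rw [if_pos (hP γ hγ)]
          exact le_of_eq (Finset.prod_congr rfl fun j _ => if_pos fun hj => hγ j hj)
        · push Not at hγ
          obtain ⟨j, hj, hne⟩ := hγ
          rw [Finset.prod_eq_zero (Finset.mem_univ j) (if_neg fun h => hne (h hj))]
          split_ifs
          · exact Finset.prod_nonneg fun i _ => hw0 i (γ i)
          · exact le_rfl

/-- **Juxtaposed deciders solve Boolean combinations** (search form). Let `fam j` (`j < m`) be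
oracle-free uniform families, `Φ x γ` a Boolean function of the input and of the tuple of answers,
computed on codes from `⟨x, y⟩` through the answer bits of `y`, and `bit x` a target bit. If for every
`x` the product measure of the answer weights gives mass `≥ 2/3` to the patterns `γ` with
`Φ x γ = bit x`, then `x ↦ [bit x]·{0,1}*` is `IsQSolvable`: the generated circuit `circ` (copies of
`x`, the `m` circuits side by side; product Born rule `probEvent_circ`), its polynomial-time generator
(`codeFP_gen`) and the post-processor `⟨x, y⟩ ↦ [Φ x (ansBits x y)]`, through
`isQSolvable_of_generated_circuits`. [cite: BennettBernsteinBrassardVazirani1997, Thm. 4.13 (independent copies side by side)]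
[cite: BernsteinVazirani1997, §8 (classical post-processing inside quantum machines)] -/
theorem isQSolvable_bit (hfree : ∀ j, (fam j).IsOracleFree) (hU : ∀ j, (fam j).IsUniform)
    (Φ : List Bool → (Fin m → Bool) → Bool) (bit : List Bool → Bool)
    (hΦ : CodeFP (pairE strE strE) strE fun p => [Φ p.1 (ansBits fam p.1 p.2)])
    (hprob : ∀ x, 2 / 3 ≤ ∑ γ : Fin m → Bool, if Φ x γ = bit x then ∏ j, answerWeight (fam j) x (γ j) else 0) :
    IsQSolvable fun x => {y | [bit x] <+: y} := by
  classical
  obtain ⟨post, hpost, hpostΦ⟩ := hΦ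
  refine isQSolvable_of_generated_circuits (fun _ _ _ hy hyz => List.IsPrefix.trans hy hyz) (circ fam)
    (circ_isOracleFree fam hfree) (one_le_W fam) (codeFP_gen fam hU) post hpost fun x => ?_
  have hev : {f : QReg (W fam x.length) | post (boolPair x (List.ofFn f)) ∈ {y | [bit x] <+: y}} =
      {f | (fun j => f (blk fam x.length j (wire0 fam x.length))) ∈ Finset.univ.filter fun γ => Φ x γ = bit x} := by
    ext f
    have hp : post (boolPair x (List.ofFn f)) = [Φ x (ansBits fam x (List.ofFn f))] := hpostΦ (x, List.ofFn f)
    simp only [Set.mem_setOf_eq, hp, List.cons_prefix_cons, List.prefix_rfl, and_true, Finset.mem_filter,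
      Finset.mem_univ, true_and, ansBits_ofFn]
    exact eq_comm
  rw [hev, probEvent_circ fam hfree, Finset.sum_filter]
  exact hprob x

/-- **Juxtaposed deciders decide Boolean combinations** (`BQP` form): under the hypotheses of
`isQSolvable_bit` with `bit = [· ∈ L]`, `L ∈ BQP` (`mem_BQP_of_isQSolvable_bit`). This is the
closure of `BQP` / `PromiseBQP` under polynomial-time truth-table combinations whose value is robust
to the answers of the families queried off their promise. [cite: BennettBernsteinBrassardVazirani1997, Thm. 4.13 and Cor. 4.15]
[cite: Watrous2009, §III.2] -/
theorem mem_BQP_of_truthTable (hfree : ∀ j, (fam j).IsOracleFree) (hU : ∀ j, (fam j).IsUniform)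
    (Φ : List Bool → (Fin m → Bool) → Bool) {L : Language Bool} (bit : List Bool → Bool)
    (hbit : ∀ x, bit x = true ↔ x ∈ L)
    (hΦ : CodeFP (pairE strE strE) strE fun p => [Φ p.1 (ansBits fam p.1 p.2)])
    (hprob : ∀ x, 2 / 3 ≤ ∑ γ : Fin m → Bool, if Φ x γ = bit x then ∏ j, answerWeight (fam j) x (γ j) else 0) :
    L ∈ BQP :=
  mem_BQP_of_isQSolvable_bit (fun _ _ => QCircuit.outputPMF_apply_holds) cliffordT_isUnitary_holds hbit
    (isQSolvable_bit fam hfree hU Φ bit hΦ hprob)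

end Juxt

end Literature.Computability.QuantumComplexity

end
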